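import Summits.QuantumAdvantage.QuantumAdvantage.Theses.SosSandwich
import Literature.Computability.QuantumComplexity.PseudoBounded
import Literature.Computability.QuantumComplexity.PolynomialMethod
import HarnessLib

/-!
# `PB-AA ⟸ AA_Q + a quantum surrogate`: the exact `K_T`-specific input needed on top of the algorithmic conjecture

Support theorem (certified composition) for route `SosSandwich`, crux `PseudoBoundedAA` (stmt-QuantumAdvantage-15237);
capstone of the dilation package `SosSandwichQueryDilation{,Address,Reduction,Affine}`.

The tree holds the lattice `AAConj ⟹ PB-AA ⟹ AA_Q` (`aaQuery_of_pseudoBoundedAA`), where `AA_Q` is the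
Aaronson–Ambainis conjecture restricted to genuine quantum acceptance probabilities (the weakest form, and the one the
random-oracle consequences consume).  This file certifies the converse bridge in its most general useful shape:

* `pseudoBoundedAA_of_aaQuery_of_querySurrogate` — **`PB-AA ⟸ AA_Q ∧ QuerySurrogate`**, where `QuerySurrogate` says:
  every `p` pseudo-bounded of order `T ≥ 1` with `Var[p] ≥ ε > 0` has a QUANTUM SURROGATE — an algorithm `Q` on some
  number `N'` of bits with `1 ≤ #queries ≤ D·(T/ε)^d` and a polynomial `q` carrying its acceptance probability — that
  RETAINS VARIANCE, `Var[q] ≥ A₀ (ε/T)^a`, and CREATES NO INFLUENCE, `∀ j ∃ i, Inf_j[q] ≤ B (T/ε)^b · Inf_i[p]`.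
  Constants: `(c', C') = (b + c(a+d), C·A₀^c/(B·D^c))` from `AA_Q`'s `(c, C)`.

The exact dilations of `SosSandwichQueryDilationReduction/Affine` (`p = L·acceptProb + κ`) are the special case
`q = (p − κ)/L`, `N' = N`; the registered `stub_levelDescent` of the crux skeleton is the special case where the surrogate is
moreover top-homogeneous (then `AA_Q` is replaced by the PROVED `Q_T` rung `queryHomogeneousRung`, but a top-homogeneous
surrogate is much harder to produce).  Honest label: composition only (audit: conditional on two unregistered hypotheses);
neither `AA_Q` nor `QuerySurrogate` is proved here.

Sources: AaronsonAmbainis2014 Conj. 6 / Conj. 4; KaniewskiLeeDewolf2015 (arXiv:1411.7280) Thm. 12;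
EscuderoGutierrez2023 (arXiv:2304.06713) Question 4.5.
-/

noncomputable section

set_option linter.dupNamespace false

namespace Summit.QuantumAdvantage.QuantumAdvantage.Theorems.SosSandwich.QueryDilation

open Finset MvPolynomial Literature.Computability.Cryptography Literature.Computability.QuantumComplexity
open Summit.QuantumAdvantage.QuantumAdvantage.Theses.SosSandwich (PseudoBoundedAA)

/-- **`PseudoBoundedAA ⟸ AA_Q ∧ QuerySurrogate`** (see the module docstring for the two hypotheses).  Proof: apply `AA_Q`
to the surrogate `q` with `ε_q = A₀(ε/T)^a`, use `1/#queries ≥ (ε/T)^d/D`, and pull the influential variable of `q` back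
to `p` through the domination clause. [cite: AaronsonAmbainis2014, Conj. 6] [cite: KaniewskiLeeDewolf2015, Thm. 12] -/
theorem pseudoBoundedAA_of_aaQuery_of_querySurrogate
    (hQ : ∃ (c : ℕ) (C : ℝ), 0 < C ∧ ∀ (N : ℕ) (Q : QQueryAlg N) (q : MvPolynomial (Fin N) ℝ) (ε : ℝ),
      1 ≤ Q.queries → (∀ x, evalBool q x = Q.acceptProb x) → 0 < ε → ε ≤ boolVariance q →
        ∃ i : Fin N, C * (ε / Q.queries) ^ c ≤ influence i q)
    (hS : ∃ (a b d : ℕ) (A₀ B D : ℝ), 0 < A₀ ∧ 0 < B ∧ 0 < D ∧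
      ∀ (N T : ℕ) (p : MvPolynomial (Fin N) ℝ) (ε : ℝ), 1 ≤ T → PseudoBounded T p → 0 < ε → ε ≤ boolVariance p →
        ∃ (N' : ℕ) (Q : QQueryAlg N') (q : MvPolynomial (Fin N') ℝ),
          1 ≤ Q.queries ∧ (Q.queries : ℝ) ≤ D * ((T : ℝ) / ε) ^ d ∧ (∀ x, evalBool q x = Q.acceptProb x) ∧
          A₀ * (ε / T) ^ a ≤ boolVariance q ∧
          ∀ j : Fin N', ∃ i : Fin N, influence j q ≤ B * ((T : ℝ) / ε) ^ b * influence i p) :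
    PseudoBoundedAA := by
  obtain ⟨c, C, hC, hQb⟩ := hQ
  obtain ⟨a, b, d, A₀, B, D, hA₀, hB, hD, hSb⟩ := hS
  refine ⟨b + c * (a + d), C * A₀ ^ c / (B * D ^ c), by positivity, fun N T p ε hT hp hε hv => ?_⟩
  have hp' : PseudoBounded T p := hp
  have hv' : ε ≤ boolVariance p := hv
  obtain ⟨N', Q, q, hT', hTq, hqa, hvar, hdom⟩ := hSb N T p ε hT hp' hε hv'
  have hTpos : (0 : ℝ) < T := by exact_mod_cast hT
  have hT'pos : (0 : ℝ) < Q.queries := by exact_mod_cast hT'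
  set s : ℝ := ε / T with hs
  have hs0 : 0 < s := div_pos hε hTpos
  -- `AA_Q` on the surrogate
  have hεq : 0 < A₀ * s ^ a := by positivity
  obtain ⟨j, hj⟩ := hQb N' Q q (A₀ * s ^ a) hT' hqa hεq hvar
  obtain ⟨i, hi⟩ := hdom j
  refine ⟨i, ?_⟩
  show C * A₀ ^ c / (B * D ^ c) * (ε / (T : ℝ)) ^ (b + c * (a + d)) ≤ influence i p
  rw [← hs]
  -- `1 / #queries ≥ s^d / D`
  have hinvq : s ^ d / D ≤ 1 / (Q.queries : ℝ) := by
    rw [div_le_div_iff₀ hD hT'pos, one_mul]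
    calc s ^ d * (Q.queries : ℝ) ≤ s ^ d * (D * ((T : ℝ) / ε) ^ d) :=
          mul_le_mul_of_nonneg_left hTq (by positivity)
      _ = D * (s * ((T : ℝ) / ε)) ^ d := by rw [mul_pow]; ring
      _ = D := by rw [hs, div_mul_div_comm, mul_comm ε, div_self (by positivity), one_pow, mul_one]
  -- `Inf_j[q] ≥ C (A₀ s^a · s^d / D)^c`
  have hj' : C * (A₀ * s ^ a * (s ^ d / D)) ^ c ≤ influence j q := by
    refine le_trans ?_ hj
    apply mul_le_mul_of_nonneg_left _ hC.le
    apply pow_le_pow_left₀ (by positivity)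
    rw [div_eq_mul_one_div (A₀ * s ^ a) (Q.queries : ℝ)]
    exact mul_le_mul_of_nonneg_left hinvq (by positivity)
  -- the domination factor: `(T/ε)^b = 1/s^b`
  have hTε : ((T : ℝ) / ε) ^ b = 1 / s ^ b := by
    rw [hs, one_div, ← inv_pow, inv_div]
  rw [hTε] at hi
  have hsb : 0 < s ^ b := by positivity
  -- assemble: `C' s^{b + c(a+d)} = s^b/B · C (A₀ s^{a+d}/D)^c ≤ s^b/B · Inf_j[q] ≤ Inf_i[p]`
  have h1 : C * A₀ ^ c / (B * D ^ c) * s ^ (b + c * (a + d)) =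
      s ^ b / B * (C * (A₀ * s ^ a * (s ^ d / D)) ^ c) := by
    have e : (A₀ * s ^ a * (s ^ d / D)) ^ c = A₀ ^ c * s ^ (c * (a + d)) / D ^ c := by
      rw [show A₀ * s ^ a * (s ^ d / D) = A₀ * s ^ (a + d) / D by rw [pow_add]; ring,
        div_pow (A₀ * s ^ (a + d)) D c, mul_pow A₀ (s ^ (a + d)) c, ← pow_mul s (a + d) c, mul_comm (a + d) c]
    rw [e, pow_add s b (c * (a + d))]
    field_simp
  rw [h1]
  calc s ^ b / B * (C * (A₀ * s ^ a * (s ^ d / D)) ^ c)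
      ≤ s ^ b / B * influence j q := mul_le_mul_of_nonneg_left hj' (by positivity)
    _ ≤ s ^ b / B * (B * (1 / s ^ b) * influence i p) := mul_le_mul_of_nonneg_left hi (by positivity)
    _ = influence i p := by field_simp

end Summit.QuantumAdvantage.QuantumAdvantage.Theorems.SosSandwich.QueryDilation

end
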